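import Summits.Ventures.QEC.CircuitDistance.PortK2Check
import HarnessLib

/-!
# P3-PORT (K1b): SOUNDNESS of the K2 checker — the stop-prefix theorem (CARD-5 Theorem 1), cube soundness, and the
# index-level ingredients of Theorem 2 (parity additivity, `(Z0)` ⇒ zero-syndrome words have ≥ 3 members, decidable
# well-formedness) (cell `qec`, experiment CDX, seat qec-cdx-type-1)
-/

namespace Summit.Ventures.QEC.CircuitDistance.K2

open Finset

/-! ## The stop-prefix theorem -/

/-- The search INVARIANT at a node: `W ⊆ x`, the other members of `x` are live, `U`/`L` are the syndrome / logical masks of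
`W`, `Wm` a mask of `W`, `card = |W|`. -/
structure K2Data.Inv (D : K2Data) (x W : Finset ℕ) (U L Wm card live : ℕ) : Prop where
  /-- the current word is inside the target -/
  sub : W ⊆ x
  /-- the rest of the target is live -/
  live : ∀ n ∈ x, n ∉ W → live.testBit n = true
  /-- `U` is the syndrome mask of `W` -/
  hU : ∀ c, U.testBit c = D.synBit W c
  /-- `L` is the logical-parity mask of `W` -/
  hL : ∀ j, L.testBit j = D.lgBit W j
  /-- `Wm` is a mask of `W` -/
  hWm : IsMask Wm W
  /-- `card` is the size of `W` -/
  hcard : card = W.card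

/-- From an accepted stop (Boolean) to the semantic stop condition. -/
theorem K2Data.stopOK_sound (D : K2Data) (T : List ℕ) {x W : Finset ℕ} {U L Wm card live : ℕ}
    (hI : D.Inv x W U L Wm card live) (h : D.stopOK T L Wm card = true) : D.StopOK T W := by
  unfold K2Data.stopOK at h
  rw [Bool.or_eq_true] at h
  rcases h with h | h
  · left
    intro j
    rw [beq_iff_eq] at h
    rw [← hI.hL j, h, Nat.zero_testBit]
  · right
    rw [Bool.and_eq_true, decide_eq_true_eq] at h
    refine ⟨by rw [← hI.hcard]; exact h.1, Wm, List.elem_iff.1 h.2, hI.hWm⟩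

/-- **STOP-PREFIX THEOREM** (CARD-5 Theorem 1). If the DFS below a node satisfying the invariant for a zero-syndrome target
`x` (inside `range N`, of size `≤ |W| + r`) returns `true`, then some zero-syndrome `S` with `W ⊆ S ⊆ x` was an ACCEPTED stop. -/
theorem K2Data.dfs_sound (D : K2Data) (hWF : D.WF) (T : List ℕ) (x : Finset ℕ) (hx : ∀ n ∈ x, n < D.N)
    (hzs : D.ZeroSyn x) :
    ∀ (r : ℕ) (W : Finset ℕ) (U L Wm card live : ℕ), D.Inv x W U L Wm card live → x.card ≤ W.card + r →
      D.dfs T r U L Wm card live = true → ∃ S, W ⊆ S ∧ S ⊆ x ∧ D.ZeroSyn S ∧ D.StopOK T S := by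
  intro r
  induction r with
  | zero =>
    intro W U L Wm card live hI hcard hdfs
    have hWx : W = x := Finset.eq_of_subset_of_card_le hI.sub (by omega)
    subst hWx
    have hU0 : U = 0 := Nat.eq_of_testBit_eq fun c => by rw [hI.hU, hzs c, Nat.zero_testBit]
    unfold K2Data.dfs at hdfs
    rw [hU0] at hdfs
    simp only [bne_self_eq_false, Bool.false_or] at hdfs
    exact ⟨W, subset_rfl, subset_rfl, hzs, D.stopOK_sound T (hU0 ▸ hI) hdfs⟩
  | succ r ih =>
    intro W U L Wm card live hI hcard hdfs
    unfold K2Data.dfs at hdfs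
    by_cases hU0 : U = 0
    · rw [if_pos hU0] at hdfs
      have hzW : D.ZeroSyn W := fun c => by rw [← hI.hU c, hU0, Nat.zero_testBit]
      exact ⟨W, subset_rfl, hI.sub, hzW, D.stopOK_sound T hI hdfs⟩
    rw [if_neg hU0] at hdfs
    -- the remaining target `Y = x \ W` is non-empty and carries the syndrome `U`
    have hUY : ∀ c, U.testBit c = D.synBit (x \ W) c := by
      intro c
      have h1 := D.synBit_sdiff hI.sub c
      rw [hzs c, ← hI.hU c] at h1
      revert h1
      cases U.testBit c <;> cases D.synBit (x \ W) c <;> simp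
    have hcardY : (x \ W).card ≤ r + 1 := by
      have := Finset.card_sdiff_add_card_eq_card hI.sub; omega
    -- the prune never fires
    have hprune : ¬ (D.M * (r + 1) < popBelow U D.C) := by
      intro hlt
      have h1 := D.popBelow_word_le (x \ W) U hUY
      have h2 : ∑ g ∈ x \ W, popBelow (D.synOf g) D.C ≤ ∑ g ∈ x \ W, D.M :=
        Finset.sum_le_sum fun g hg => hWF.2.1 g (hx g (Finset.mem_sdiff.1 hg).1)
      rw [Finset.sum_const, smul_eq_mul] at h2
      have h3 : (x \ W).card * D.M ≤ (r + 1) * D.M := Nat.mul_le_mul_right _ hcardY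
      have : popBelow U D.C ≤ D.M * (r + 1) := by
        calc popBelow U D.C ≤ (x \ W).card * D.M := h1.trans h2
          _ ≤ (r + 1) * D.M := h3
          _ = D.M * (r + 1) := Nat.mul_comm _ _
      omega
    rw [if_neg hprune] at hdfs
    -- the branching check
    have hhigh : ∀ c, D.C ≤ c → U.testBit c = false := by
      intro c hc
      rw [hI.hU c]
      unfold K2Data.synBit
      rw [decide_eq_false_iff_not]
      have : W.filter (fun n => (D.synOf n).testBit c = true) = ∅ := by
        rw [Finset.filter_eq_empty_iff]
        intro n hn hb
        have hlt : D.synOf n < 2 ^ D.C := hWF.1 n (hx n (hI.sub hn))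
        have : D.synOf n < 2 ^ c := lt_of_lt_of_le hlt (Nat.pow_le_pow_right (by norm_num) hc)
        rw [Nat.testBit_lt_two_pow this] at hb
        exact Bool.false_ne_true hb
      rw [this]; simp
    obtain ⟨hc₀C, hc₀⟩ := firstBit_spec hU0 hhigh
    set c₀ := firstBit U D.C
    -- a member of `x \ W` through `c₀`
    have hQex : ∃ h ∈ D.candOf c₀, h ∈ x \ W := by
      rw [hUY] at hc₀
      obtain ⟨g, hg, hgb⟩ := D.exists_of_synBit hc₀
      exact ⟨g, hWF.2.2 g (hx g (Finset.mem_sdiff.1 hg).1) c₀ hc₀C hgb, hg⟩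
    have hQlive : ∀ n, n ∈ x \ W → live.testBit n = true :=
      fun n hn => hI.live n (Finset.mem_sdiff.1 hn).1 (Finset.mem_sdiff.1 hn).2
    obtain ⟨h, -, hhY, live', hk, hrest, -⟩ :=
      D.goList_sound (D.dfs T r) U L Wm card (fun n => n ∈ x \ W) _ _ hdfs hQex hQlive
    obtain ⟨hhx, hhW⟩ := Finset.mem_sdiff.1 hhY
    -- the invariant at the child
    have hI' : D.Inv x (insert h W) (U ^^^ D.synOf h) (L ^^^ D.lgOf h) (Wm ||| 2 ^ h) (card + 1) live' := by
      refine ⟨Finset.insert_subset hhx hI.sub, fun n hn hnW => ?_, fun c => ?_, fun j => ?_, fun n => ?_, ?_⟩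
      · rw [Finset.mem_insert, not_or] at hnW
        exact hrest n (Finset.mem_sdiff.2 ⟨hn, hnW.2⟩) hnW.1
      · rw [Nat.testBit_xor, hI.hU c, D.synBit_insert hhW c, Bool.xor_comm]
      · rw [Nat.testBit_xor, hI.hL j, D.lgBit_insert hhW j, Bool.xor_comm]
      · rw [Nat.testBit_or, Nat.testBit_two_pow, hI.hWm n]
        by_cases h1 : n = h
        · subst h1; simp
        · have h1' : h ≠ n := fun e => h1 e.symm
          by_cases h2 : n ∈ W <;> simp [h1, h1', h2]
      · rw [hI.hcard, Finset.card_insert_of_notMem hhW]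
    have hcard' : x.card ≤ (insert h W).card + r := by rw [Finset.card_insert_of_notMem hhW]; omega
    obtain ⟨S, hWS, hSx, hzS, hok⟩ := ih (insert h W) _ _ _ _ _ hI' hcard' hk
    exact ⟨S, (Finset.subset_insert h W).trans hWS, hSx, hzS, hok⟩

/-- **CUBE SOUNDNESS.** If `cube T p live = true`, every zero-syndrome target `x ∋ p` inside `range N` of size `≤ w` whose
other members are all live contains an accepted stop through `p`. -/
theorem K2Data.cube_sound (D : K2Data) (hWF : D.WF) (T : List ℕ) (p live : ℕ) (h : D.cube T p live = true)
    (x : Finset ℕ) (hx : ∀ n ∈ x, n < D.N) (hzs : D.ZeroSyn x) (hp : p ∈ x) (hcard : x.card ≤ D.w)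
    (hlive : ∀ n ∈ x, n ≠ p → live.testBit n = true) :
    ∃ S, p ∈ S ∧ S ⊆ x ∧ D.ZeroSyn S ∧ D.StopOK T S := by
  have hI : D.Inv x {p} (D.synOf p) (D.lgOf p) (2 ^ p) 1 live := by
    refine ⟨Finset.singleton_subset_iff.2 hp, fun n hn hnp => hlive n hn (fun e => hnp (e ▸ Finset.mem_singleton_self _)),
      fun c => ?_, fun j => ?_, fun n => ?_, by simp⟩
    · unfold K2Data.synBit
      by_cases hb : (D.synOf p).testBit c = true
      · rw [hb]; simp [Finset.filter_singleton, hb]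
      · rw [Bool.not_eq_true] at hb; rw [hb]; simp [Finset.filter_singleton, hb]
    · unfold K2Data.lgBit
      by_cases hb : (D.lgOf p).testBit j = true
      · rw [hb]; simp [Finset.filter_singleton, hb]
      · rw [Bool.not_eq_true] at hb; rw [hb]; simp [Finset.filter_singleton, hb]
    · rw [Nat.testBit_two_pow]
      by_cases e : p = n
      · subst e; simp
      · have e' : n ≠ p := fun h => e h.symm
        simp [e, e']
  have hw : x.card ≤ ({p} : Finset ℕ).card + (D.w - 1) := by
    rw [Finset.card_singleton]; have := Finset.card_pos.2 ⟨p, hp⟩; omega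
  obtain ⟨S, hpS, hSx, hzS, hok⟩ := D.dfs_sound hWF T x hx hzs (D.w - 1) {p} _ _ _ _ _ hI hw h
  exact ⟨S, hpS (Finset.mem_singleton_self p), hSx, hzS, hok⟩


/-! ## Index-level facts for Theorem 2: parity additivity and the `(Z0)` weight bound -/

/-- Logical bits split over a subset. -/
theorem K2Data.lgBit_sdiff (D : K2Data) {W x : Finset ℕ} (hW : W ⊆ x) (j : ℕ) :
    D.lgBit x j = xor (D.lgBit W j) (D.lgBit (x \ W) j) := by
  unfold K2Data.lgBit
  have : x.filter (fun n => (D.lgOf n).testBit j = true) =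
      W.filter (fun n => (D.lgOf n).testBit j = true) ∪ (x \ W).filter (fun n => (D.lgOf n).testBit j = true) := by
    rw [← Finset.filter_union, Finset.union_sdiff_of_subset hW]
  rw [this, Finset.card_union_of_disjoint (Finset.disjoint_filter_filter Finset.disjoint_sdiff), decide_odd_add]

/-- Zero syndrome passes to the complement of a zero-syndrome subset. -/
theorem K2Data.zeroSyn_sdiff (D : K2Data) {W x : Finset ℕ} (hW : W ⊆ x) (hx : D.ZeroSyn x) (hWz : D.ZeroSyn W) :
    D.ZeroSyn (x \ W) := by
  intro c
  have := D.synBit_sdiff hW c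
  rw [hx c, hWz c] at this
  revert this; cases D.synBit (x \ W) c <;> simp

/-- DECIDABLE `(Z0)`: all generator syndromes are non-zero and pairwise distinct. -/
def K2Data.z0Check (D : K2Data) : Bool :=
  ((List.range D.N).all fun n => D.synOf n != 0) &&
  ((List.range D.N).all fun a => (List.range D.N).all fun b => (a == b) || (D.synOf a != D.synOf b))

/-- The syndrome mask of a singleton / the `xor` of a pair, from the parity bits. -/
theorem K2Data.synBit_singleton (D : K2Data) (n c : ℕ) : D.synBit {n} c = (D.synOf n).testBit c := by
  unfold K2Data.synBit
  by_cases hb : (D.synOf n).testBit c = true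
  · rw [hb]; simp [Finset.filter_singleton, hb]
  · rw [Bool.not_eq_true] at hb; rw [hb]; simp [Finset.filter_singleton, hb]

/-- **`(Z0)` ⇒ every non-empty zero-syndrome word has at least three members.** -/
theorem K2Data.three_le_card_of_zeroSyn (D : K2Data) (hZ : D.z0Check = true) {y : Finset ℕ} (hy : ∀ n ∈ y, n < D.N)
    (hzs : D.ZeroSyn y) (hne : y.Nonempty) : 3 ≤ y.card := by
  unfold K2Data.z0Check at hZ
  simp only [Bool.and_eq_true, List.all_eq_true, List.mem_range, Bool.or_eq_true, beq_iff_eq, bne_iff_ne, ne_eq] at hZ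
  obtain ⟨h0, hd⟩ := hZ
  by_contra hlt
  have hcard : y.card = 1 ∨ y.card = 2 := by have := Finset.card_pos.2 hne; omega
  rcases hcard with h1 | h2
  · obtain ⟨a, rfl⟩ := Finset.card_eq_one.1 h1
    apply h0 a (hy a (Finset.mem_singleton_self a))
    apply Nat.eq_of_testBit_eq
    intro c
    rw [Nat.zero_testBit, ← D.synBit_singleton, hzs c]
  · obtain ⟨a, b, hab, rfl⟩ := Finset.card_eq_two.1 h2
    have ha : a < D.N := hy a (by simp)
    have hb : b < D.N := hy b (by simp)
    rcases hd a ha b hb with h | h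
    · exact hab h
    · apply h
      apply Nat.eq_of_testBit_eq
      intro c
      have := hzs c
      unfold K2Data.synBit at this
      rw [Finset.filter_insert, Finset.filter_singleton] at this
      by_cases h1 : (D.synOf a).testBit c = true <;> by_cases h2 : (D.synOf b).testBit c = true
      · rw [h1, h2]
      · exfalso; rw [if_pos h1, if_neg h2] at this; simp at this
      · exfalso; rw [if_neg h1, if_pos h2] at this; simp at this
      · rw [Bool.not_eq_true] at h1 h2; rw [h1, h2]

/-- DECIDABLE well-formedness of the data. -/
def K2Data.wfCheck (D : K2Data) : Bool :=
  ((List.range D.N).all fun n => decide (D.synOf n < 2 ^ D.C) && decide (popBelow (D.synOf n) D.C ≤ D.M) &&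
    (List.range D.C).all fun c => !(D.synOf n).testBit c || (D.candOf c).elem n)

/-- The decidable check implies `WF`. -/
theorem K2Data.wf_of_check (D : K2Data) (h : D.wfCheck = true) : D.WF := by
  unfold K2Data.wfCheck at h
  simp only [List.all_eq_true, List.mem_range, Bool.and_eq_true, decide_eq_true_eq, Bool.or_eq_true,
    Bool.not_eq_true'] at h
  refine ⟨fun n hn => (h n hn).1.1, fun n hn => (h n hn).1.2, fun n hn c hc hb => ?_⟩
  rcases (h n hn).2 c hc with h' | h'
  · rw [h'] at hb; exact absurd hb Bool.false_ne_true
  · exact List.elem_iff.1 h'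

end Summit.Ventures.QEC.CircuitDistance.K2
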